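import Literature.RingTheory.FormalGroups.FormalGroupHomDerivative   -- ★ `φ′(0) = 0 ⇒ φ′ = 0` for homomorphisms (p844680)
import Mathlib.RingTheory.PowerSeries.Expand
import Mathlib.RingTheory.MvPowerSeries.Expand
import Mathlib.RingTheory.PowerSeries.Order
import Mathlib.Algebra.CharP.Invertible
import Mathlib.Algebra.CharP.Frobenius
import HarnessLib

/-!
# Frobenius factorisation (height) of homomorphisms of one-dimensional formal group laws in characteristic `p`:
# `f(X) = g(X^{p^n})` with `g` a homomorphism from the Frobenius twist and `g′(0) ≠ 0`
# ([Fröhlich 1968] Ch. I §3 Thm. 2; [Hazewinkel 1978] §18.3; [Harris–Taylor 2001] §II.1)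

Topic `Literature/RingTheory/FormalGroups`; namespace `Literature.RingTheory.FormalGroups`.  THEOREMS ONLY (no definition,
no named fact, no instance, no notation, no `sorry`); carrier = Mathlib `FormalGroup` ∕ `FormalGroup.map` + ★ `FormalGroupHom`,
Mathlib `PowerSeries.expand` ∕ `MvPowerSeries.expand`, `frobenius` ∕ `iterateFrobenius`.  Sequel of ★ `FormalGroupHomDerivative`
(the derivative identity).  Cell `hodgecm-mathlib`, P6 «MOD programme», sub-desk F0P6d: generic organ (K-org2, second file) under
the letter (HL-A) `HeightDichotomy` of `Cruxes/HLiu418/Lines/F0_P6d_FormalModuleKernels.lean` — it delivers the dichotomy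
«`[ϖ]_F = 0` or `[ϖ]_F(X) = g(X^{p^n})` with `g′(0) ≠ 0` (a unit over a field)» for ANY homomorphism; the remaining step of
HL-A («`p^n` is a power of `q`», from the `𝒪`-linearity) is not in this file.  HC_CM is proved only modulo the printed
citations until rung 0 closes; nothing here is about HC.

THE PRINT.  [Frohlich1968] Ch. I §3: Lemma — over a ring of characteristic `p`, `φ′ = 0 ⇔ φ ∈ R⟦X^p⟧`; Thm. 2 — a nonzero
homomorphism `f : F → G` of one-dimensional formal group laws over `R` of characteristic `p` has a unique expression
`f(X) = g(X^{p^h})` with `g′(0) ≠ 0`; `p^h` is the HEIGHT of `f` (and `g` is a homomorphism `F^{(p^h)} → G` from the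
Frobenius twist).  [Hazewinkel1978] §18.3 (18.3.1)–(18.3.3) is the same; [HarrisTaylorAMS2001] §II.1 p. 59 applies it to
`[ϖ]_F` of a formal `𝒪`-module over a field (`[ϖ](X) = u(X^{q^h})`, the normal form ★ `FormalOModuleLaw.IsOfHeight`).

MAIN STATEMENTS.  §1 (`[Fact p.Prime] [CharP R p]`): `derivative_expand_eq_zero`, `coeff_eq_zero_of_derivative_eq_zero`,
**`eq_expand_of_derivative_eq_zero`** (`φ′ = 0 ⇒ φ = expand p (Σ a_{pm} X^m)`), `derivative_eq_zero_iff_exists_expand`.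
§2 (any `R`, any `τ : R →+* R` and `q ≠ 0` with `τ_*F (X^q,Y^q) = F^q`): **`FormalGroupHom.exists_hom_map_of_eq_expand`** — if a
homomorphism `f : F → G` is `φ(X^q)` then `φ` is a homomorphism `τ_* F → G` (used with `τ = frobenius R p`, `q = p`, Mathlib
`MvPowerSeries.map_frobenius_expand`, and with `τ = iterateFrobenius R p n`, `q = p^n`, Mathlib `map_iterateFrobenius_expand`).
§3 (`[Fact p.Prime] [CharP R p]`): **`FormalGroupHom.exists_eq_expand_of_coeff_one_eq_zero`** (ONE FROBENIUS STEP: `f′(0) = 0 ⇒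
f = g(X^p)`, `g : F^{(p)} → G`), **`FormalGroupHom.exists_eq_expand_pow_coeff_one_ne_zero`** (THE HEIGHT FACTORISATION:
`f ≠ 0 ⇒ f = g(X^{p^n})`, `g : F^{(p^n)} → G`, `g′(0) ≠ 0`), `FormalGroupHom.eq_zero_or_exists_eq_expand_pow` (dichotomy form),
`FormalGroupHom.exists_eq_expand_pow_isUnit` (over a field: `g′(0) ∈ kˣ`).  §4 (ED. 2) UNIQUENESS: `coeff_expand_self`,
`coeff_expand_eq_zero_of_lt`, `eq_of_expand_eq_expand`, `expand_injective`, **`FormalGroupHom.expand_pow_unique`** (`n` and the series of `g` are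
unique — Fröhlich's «unique expression»).  Private plumbing ([folklore]):
`mvPowerSeries_expand_injective`, `mvPowerSeries_expand_eq_subst`, `hasSubst_subst_of_constantCoeff`, `subst_vec2`.

## References
* [Frohlich1968] A. Fröhlich, *Formal Groups*, LNM 74 (1968), Ch. I §3, Lemma 2 and Thm. 2.
* [Hazewinkel1978] M. Hazewinkel, *Formal Groups and Applications* (1978), §18.3, (18.3.1)–(18.3.3).
* [HarrisTaylorAMS2001] M. Harris, R. Taylor, *The Geometry and Cohomology of Some Simple Shimura Varieties*, Ann. of Math.
  Stud. 151 (2001), §II.1 (p. 59).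
-/

noncomputable section

namespace Literature.RingTheory.FormalGroups

open _root_.MvPowerSeries (HasSubst subst)

universe u

variable {R : Type u} [CommRing R]

/-! ## §1 Characteristic `p` calculus: `φ′ = 0 ↔ φ(X) = φ₁(X^p)` -/

section CharP

variable (p : ℕ) [hp : Fact p.Prime] [CharP R p]

/-- In characteristic `p`, `(d/dX) φ₁(X^p) = 0`. [cite: Frohlich1968, Ch. I §3 Lemma 2] -/
theorem derivative_expand_eq_zero (φ₁ : PowerSeries R) :
    PowerSeries.derivative R (PowerSeries.expand p hp.out.ne_zero φ₁) = 0 := by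
  ext n
  rw [PowerSeries.coeff_derivative, map_zero, PowerSeries.coeff_expand]
  split_ifs with h
  · have h0 : ((n + 1 : ℕ) : R) = 0 := (CharP.cast_eq_zero_iff R p (n + 1)).mpr h
    rw [← Nat.cast_succ, h0, mul_zero]
  · rw [zero_mul]

/-- In characteristic `p`, `φ′ = 0` kills every coefficient of index prime to `p`. [cite: Frohlich1968, Ch. I §3 Lemma 2] -/
theorem coeff_eq_zero_of_derivative_eq_zero {φ : PowerSeries R} (h : PowerSeries.derivative R φ = 0) {n : ℕ}
    (hn : ¬p ∣ n) : PowerSeries.coeff n φ = 0 := by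
  obtain ⟨m, rfl⟩ : ∃ m, n = m + 1 := ⟨n - 1, by
    rcases Nat.eq_zero_or_pos n with h0 | h0
    · exact absurd (h0 ▸ dvd_zero p) hn
    · omega⟩
  have hc := PowerSeries.ext_iff.mp h m
  rw [PowerSeries.coeff_derivative, map_zero] at hc
  have hu : IsUnit ((m + 1 : ℕ) : R) := (CharP.isUnit_natCast_iff (R := R) hp.out).mpr hn
  rw [Nat.cast_succ] at hu
  exact hu.mul_left_eq_zero.mp hc

/-- In characteristic `p`, **`φ′ = 0 ⇒ φ(X) = φ₁(X^p)`** with `φ₁ = Σ a_{pm} X^m`. [cite: Frohlich1968, Ch. I §3 Lemma 2] -/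
theorem eq_expand_of_derivative_eq_zero {φ : PowerSeries R} (h : PowerSeries.derivative R φ = 0) :
    φ = PowerSeries.expand p hp.out.ne_zero (PowerSeries.mk fun m => PowerSeries.coeff (p * m) φ) := by
  ext n
  rw [PowerSeries.coeff_expand]
  split_ifs with hn
  · obtain ⟨m, rfl⟩ := hn
    rw [PowerSeries.coeff_mk, Nat.mul_div_cancel_left _ hp.out.pos]
  · exact coeff_eq_zero_of_derivative_eq_zero p h hn

/-- In characteristic `p`, **`φ′ = 0 ↔ φ(X) = φ₁(X^p)` for some `φ₁`**. [cite: Frohlich1968, Ch. I §3 Lemma 2] -/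
theorem derivative_eq_zero_iff_exists_expand (φ : PowerSeries R) :
    PowerSeries.derivative R φ = 0 ↔ ∃ φ₁, φ = PowerSeries.expand p hp.out.ne_zero φ₁ :=
  ⟨fun h => ⟨_, eq_expand_of_derivative_eq_zero p h⟩, fun ⟨φ₁, h⟩ => h ▸ derivative_expand_eq_zero p φ₁⟩

end CharP

/-! ## §2 The Frobenius twist: `φ(X) = φ₁(X^q)` with `φ` a homomorphism `F → G` ⇒ `φ₁ : F^{(q)} → G` is one -/

/-- `expand` is injective on multivariate power series. [folklore] -/
private theorem mvPowerSeries_expand_injective {σ : Type*} (q : ℕ) (hq : q ≠ 0) :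
    Function.Injective (MvPowerSeries.expand q hq : MvPowerSeries σ R → MvPowerSeries σ R) := by
  intro H H' h
  ext m
  rw [← MvPowerSeries.coeff_expand_smul q hq H m, h, MvPowerSeries.coeff_expand_smul]

/-- `MvPowerSeries.expand q` is the substitution `Xᵢ ↦ Xᵢ^q`. [folklore] -/
private theorem mvPowerSeries_expand_eq_subst {σ : Type*} (q : ℕ) (hq : q ≠ 0) (H : MvPowerSeries σ R) :
    MvPowerSeries.expand q hq H = subst (fun i => (MvPowerSeries.X i : MvPowerSeries σ R) ^ q) H := by
  simp only [MvPowerSeries.expand, MvPowerSeries.substAlgHom_apply]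

/-- A series with vanishing constant term stays substitutable after substitution. [folklore] -/
private theorem hasSubst_subst_of_constantCoeff {φ : PowerSeries R} (hφ : PowerSeries.constantCoeff φ = 0)
    {τ : Type*} {a : MvPowerSeries τ R} (ha : PowerSeries.HasSubst a) :
    PowerSeries.HasSubst (PowerSeries.subst a φ) := by
  have h := PowerSeries.HasSubst.comp (PowerSeries.HasSubst.of_constantCoeff_zero' hφ) ha
  rwa [PowerSeries.coe_substAlgHom ha] at h

/-- Entrywise substitution into a `2`-vector (private plumbing). [folklore] -/
private theorem subst_vec2 {τ υ : Type*} (b : τ → MvPowerSeries υ R) (u v : MvPowerSeries τ R) :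
    (fun s => subst b ((![u, v] : Fin 2 → MvPowerSeries τ R) s)) = ![subst b u, subst b v] := by
  funext s; fin_cases s <;> simp

/-- **The Frobenius twist of a homomorphism.**  Let `τ : R →+* R` and `q ≠ 0` be such that `F^{(τ)}(X^q, Y^q) = F(X,Y)^q`
(`τ` the `q`-th power Frobenius of a ring of characteristic `p`, `q = p^n`: Mathlib `MvPowerSeries.map_iterateFrobenius_expand`).
If a homomorphism `f : F → G` factors as `f(X) = φ(X^q)`, then `φ` is a homomorphism `F^{(τ)} → G`
(`φ(F^{(τ)}(X^q,Y^q)) = φ(F^q) = f(F) = G(f X, f Y) = G(φ(X^q), φ(Y^q))` and `X ↦ X^q` is injective).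
[cite: Frohlich1968, Ch. I §3 Thm. 2 (proof)] [cite: Hazewinkel1978, (18.3.1)] -/
theorem FormalGroupHom.exists_hom_map_of_eq_expand {F G : FormalGroup R} (f : FormalGroupHom F G) (τ : R →+* R)
    (q : ℕ) (hq : q ≠ 0)
    (hF : MvPowerSeries.map τ (MvPowerSeries.expand q hq F.toPowerSeries) = F.toPowerSeries ^ q)
    (φ : PowerSeries R) (h : f.toPowerSeries = PowerSeries.expand q hq φ) :
    ∃ g : FormalGroupHom (F.map τ) G, g.toPowerSeries = φ := by
  have ha : HasSubst (fun i : Fin 2 => (MvPowerSeries.X i : MvPowerSeries (Fin 2) R) ^ q) :=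
    MvPowerSeries.HasSubst.X_pow hq
  have hφ0 : PowerSeries.constantCoeff φ = 0 := by
    rw [← PowerSeries.constantCoeff_expand q hq φ, ← h]; exact f.constantCoeff_eq_zero
  have hφ : PowerSeries.HasSubst φ := PowerSeries.HasSubst.of_constantCoeff_zero' hφ0
  have hv : HasSubst ![PowerSeries.subst (MvPowerSeries.X 0 : MvPowerSeries (Fin 2) R) φ,
      PowerSeries.subst (MvPowerSeries.X 1 : MvPowerSeries (Fin 2) R) φ] :=
    hasSubst_pair (hasSubst_subst_of_constantCoeff hφ0 (PowerSeries.HasSubst.X 0))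
      (hasSubst_subst_of_constantCoeff hφ0 (PowerSeries.HasSubst.X 1))
  -- `F^{(τ)}(X^q, Y^q) = F^q`, as a substitution
  have hFq : subst (fun i : Fin 2 => (MvPowerSeries.X i : MvPowerSeries (Fin 2) R) ^ q) (F.map τ).toPowerSeries =
      F.toPowerSeries ^ q := by
    rw [← mvPowerSeries_expand_eq_subst q hq, FormalGroup.map_toPowerSeries, ← MvPowerSeries.map_expand, hF]
  refine ⟨⟨φ, hφ0, ?_⟩, rfl⟩
  apply mvPowerSeries_expand_injective q hq
  rw [mvPowerSeries_expand_eq_subst, mvPowerSeries_expand_eq_subst]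
  -- the homomorphism identity of `f = φ(X^q)`
  have key := f.map_add
  rw [h, PowerSeries.expand_apply,
    PowerSeries.subst_comp_subst_apply (PowerSeries.HasSubst.X_pow hq) (hasSubst_formalGroup F),
    PowerSeries.subst_comp_subst_apply (PowerSeries.HasSubst.X_pow hq) (PowerSeries.HasSubst.X 0),
    PowerSeries.subst_comp_subst_apply (PowerSeries.HasSubst.X_pow hq) (PowerSeries.HasSubst.X 1),
    PowerSeries.subst_pow (hasSubst_formalGroup F), PowerSeries.subst_pow (PowerSeries.HasSubst.X 0),
    PowerSeries.subst_pow (PowerSeries.HasSubst.X 1), PowerSeries.subst_X (hasSubst_formalGroup F),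
    PowerSeries.subst_X (PowerSeries.HasSubst.X 0), PowerSeries.subst_X (PowerSeries.HasSubst.X 1), ← hFq,
    ← subst_powerSeries_subst (hasSubst_formalGroup (F.map τ)) ha] at key
  -- key : subst a (φ(F^{(τ)})) = G.subst ![φ((X 0)^q), φ((X 1)^q)]
  rw [key, MvPowerSeries.subst_comp_subst_apply hv ha, subst_vec2,
    subst_powerSeries_subst (PowerSeries.HasSubst.X 0) ha, subst_powerSeries_subst (PowerSeries.HasSubst.X 1) ha,
    MvPowerSeries.subst_X ha, MvPowerSeries.subst_X ha]


/-! ## §3 Homomorphisms in characteristic `p`: one Frobenius step, and the height factorisation -/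

section Height

variable (p : ℕ) [hp : Fact p.Prime] [CharP R p]

/-- **One Frobenius step**: in characteristic `p`, a homomorphism `f : F → G` with `f′(0) = 0` is `f(X) = g(X^p)` for a
homomorphism `g : F^{(p)} → G` from the Frobenius twist `F^{(p)} = (frobenius R p)_* F`.
[cite: Frohlich1968, Ch. I §3 Thm. 2 (proof)] [cite: Hazewinkel1978, (18.3.1)] -/
theorem FormalGroupHom.exists_eq_expand_of_coeff_one_eq_zero {F G : FormalGroup R} (f : FormalGroupHom F G)
    (h1 : PowerSeries.coeff 1 f.toPowerSeries = 0) :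
    ∃ g : FormalGroupHom (F.map (frobenius R p)) G,
      f.toPowerSeries = PowerSeries.expand p hp.out.ne_zero g.toPowerSeries := by
  have he := eq_expand_of_derivative_eq_zero p (f.derivative_eq_zero_of_coeff_one_eq_zero h1)
  obtain ⟨g, hg⟩ := f.exists_hom_map_of_eq_expand (frobenius R p) p hp.out.ne_zero
    (MvPowerSeries.map_frobenius_expand p hp.out.ne_zero) _ he
  exact ⟨g, hg ▸ he⟩

/-- **Height factorisation of a homomorphism in characteristic `p`** ([Frohlich1968] Ch. I §3 Thm. 2): a NONZERO homomorphism
`f : F → G` of one-dimensional formal group laws over a ring of characteristic `p` is `f(X) = g(X^{p^n})` for some `n` and a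
homomorphism `g : F^{(p^n)} → G` (from the twist by the `n`-th iterated Frobenius) WITH `g′(0) ≠ 0`.  (Proof: take `n`
maximal with `f ∈ R⟦X^{p^n}⟧` — bounded by the order of `f`; the factor is a homomorphism by
`exists_hom_map_of_eq_expand`, and `g′(0) = 0` would give one more Frobenius step.)
[cite: Frohlich1968, Ch. I §3 Thm. 2] [cite: Hazewinkel1978, (18.3.3)] -/
theorem FormalGroupHom.exists_eq_expand_pow_coeff_one_ne_zero {F G : FormalGroup R} (f : FormalGroupHom F G)
    (hf : f.toPowerSeries ≠ 0) :
    ∃ (n : ℕ) (g : FormalGroupHom (F.map (iterateFrobenius R p n)) G),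
      f.toPowerSeries = PowerSeries.expand (p ^ n) (pow_ne_zero n hp.out.ne_zero) g.toPowerSeries ∧
        PowerSeries.coeff 1 g.toPowerSeries ≠ 0 := by
  classical
  have hp0 : p ≠ 0 := hp.out.ne_zero
  set P : ℕ → Prop := fun n =>
    ∃ φ : PowerSeries R, f.toPowerSeries = PowerSeries.expand (p ^ n) (pow_ne_zero n hp0) φ with hP
  -- the order of `f` bounds `n`
  obtain ⟨N, hN⟩ : ∃ N : ℕ, (N : ℕ∞) = f.toPowerSeries.order :=
    ENat.ne_top_iff_exists.mp (PowerSeries.order_eq_top.not.mpr hf)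
  have hbound : ∀ n, P n → n ≤ N := by
    rintro n ⟨φ, hφ⟩
    have hφ0 : φ ≠ 0 := by
      rintro rfl; exact hf (by rw [hφ, map_zero])
    obtain ⟨k, hk⟩ : ∃ k : ℕ, (k : ℕ∞) = φ.order := ENat.ne_top_iff_exists.mp (PowerSeries.order_eq_top.not.mpr hφ0)
    have hk1 : 1 ≤ k := by
      have h1 : (1 : ℕ∞) ≤ φ.order := by
        refine PowerSeries.nat_le_order φ 1 fun i hi => ?_
        obtain rfl : i = 0 := by omega
        rw [PowerSeries.coeff_zero_eq_constantCoeff, ← PowerSeries.constantCoeff_expand (p ^ n) (pow_ne_zero n hp0) φ,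
          ← hφ]
        exact f.constantCoeff_eq_zero
      rw [← hk] at h1; exact_mod_cast h1
    have hord : (N : ℕ∞) = ((p ^ n * k : ℕ) : ℕ∞) := by
      rw [hN, hφ, PowerSeries.order_expand, ← hk, Nat.cast_mul]; rfl
    have hNk : N = p ^ n * k := by exact_mod_cast hord
    calc n ≤ p ^ n := (Nat.lt_pow_self hp.out.one_lt).le
      _ ≤ p ^ n * k := Nat.le_mul_of_pos_right _ hk1
      _ = N := hNk.symm
  have hP0 : P 0 := ⟨f.toPowerSeries, (PowerSeries.expand_one_apply _).symm⟩
  set n := Nat.findGreatest P N with hn_def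
  have hn : P n := Nat.findGreatest_spec (Nat.zero_le N) hP0
  have hmax : ¬P (n + 1) := fun h =>
    Nat.findGreatest_is_greatest (Nat.lt_succ_self n) (hbound _ h) h
  obtain ⟨φ, hφ⟩ := hn
  obtain ⟨g, rfl⟩ := f.exists_hom_map_of_eq_expand (iterateFrobenius R p n) (p ^ n) (pow_ne_zero n hp0)
    (MvPowerSeries.map_iterateFrobenius_expand p hp0 _ n) φ hφ
  refine ⟨n, g, hφ, fun h1 => hmax ?_⟩
  -- `g′(0) = 0` would give one more step
  have he := eq_expand_of_derivative_eq_zero p (g.derivative_eq_zero_of_coeff_one_eq_zero h1)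
  set ψ : PowerSeries R := PowerSeries.mk fun m => PowerSeries.coeff (p * m) g.toPowerSeries with hψ
  change ∃ χ, _
  refine ⟨ψ, ?_⟩
  rw [hφ, he, ← PowerSeries.expand_mul]
  rfl

/-- The same as a dichotomy: `f = 0`, or `f(X) = g(X^{p^n})` with `g` a homomorphism from the `n`-th Frobenius twist and
`g′(0) ≠ 0`. [cite: Frohlich1968, Ch. I §3 Thm. 2] -/
theorem FormalGroupHom.eq_zero_or_exists_eq_expand_pow {F G : FormalGroup R} (f : FormalGroupHom F G) :
    f.toPowerSeries = 0 ∨ ∃ (n : ℕ) (g : FormalGroupHom (F.map (iterateFrobenius R p n)) G),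
      f.toPowerSeries = PowerSeries.expand (p ^ n) (pow_ne_zero n hp.out.ne_zero) g.toPowerSeries ∧
        PowerSeries.coeff 1 g.toPowerSeries ≠ 0 := by
  by_cases hf : f.toPowerSeries = 0
  · exact Or.inl hf
  · exact Or.inr (f.exists_eq_expand_pow_coeff_one_ne_zero p hf)

/-- Over a FIELD of characteristic `p` the leading coefficient `g′(0)` of the height factorisation is a unit, so that
`f(X) = u(X^{p^n})` with `u ∈ X·k⟦X⟧`, `u′(0) ∈ kˣ` — the normal form behind ★ `FormalOModuleLaw.IsOfHeight` ∕ ★ `IsOfPHeight`.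
[cite: Frohlich1968, Ch. I §3 Thm. 2] [cite: HarrisTaylorAMS2001, §II.1 (p. 59)] -/
theorem FormalGroupHom.exists_eq_expand_pow_isUnit {K : Type u} [Field K] [CharP K p] {F G : FormalGroup K}
    (f : FormalGroupHom F G) (hf : f.toPowerSeries ≠ 0) :
    ∃ (n : ℕ) (g : FormalGroupHom (F.map (iterateFrobenius K p n)) G),
      f.toPowerSeries = PowerSeries.expand (p ^ n) (pow_ne_zero n hp.out.ne_zero) g.toPowerSeries ∧
        IsUnit (PowerSeries.coeff 1 g.toPowerSeries) := by
  obtain ⟨n, g, hg, h1⟩ := f.exists_eq_expand_pow_coeff_one_ne_zero p hf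
  exact ⟨n, g, hg, Ne.isUnit h1⟩

end Height

/-! ## §4 ED. 2 — UNIQUENESS in the height factorisation ([Frohlich1968] Ch. I §3 Thm. 2: «a unique expression») -/

section Unique

variable {q q' : ℕ}

/-- The `q`-th coefficient of `g(X^q)` is the linear coefficient of `g`. [cite: Frohlich1968, Ch. I §3 Thm. 2] -/
theorem coeff_expand_self (hq : q ≠ 0) (g : PowerSeries R) :
    PowerSeries.coeff q (PowerSeries.expand q hq g) = PowerSeries.coeff 1 g := by
  have h := PowerSeries.coeff_expand_mul q hq g 1
  rwa [mul_one] at h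

/-- Below the index `q`, `g(X^q)` with `g(0) = 0` has no coefficients. [cite: Frohlich1968, Ch. I §3 Thm. 2] -/
theorem coeff_expand_eq_zero_of_lt (hq : q ≠ 0) {g : PowerSeries R} (hg : PowerSeries.constantCoeff g = 0) {j : ℕ}
    (hj : j < q) : PowerSeries.coeff j (PowerSeries.expand q hq g) = 0 := by
  rw [PowerSeries.coeff_expand]
  split_ifs with h
  · rcases Nat.eq_zero_or_pos j with rfl | hj0
    · rw [Nat.zero_div, PowerSeries.coeff_zero_eq_constantCoeff, hg]
    · exact absurd (Nat.le_of_dvd hj0 h) (not_le.mpr hj)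
  · rfl

/-- **Uniqueness of the exponent**: if `g(X^q) = g′(X^{q′})` with `g(0) = g′(0) = 0` and `g′(0)`-coefficients `g′(0) ≠ 0 ≠ g′′(0)` — i.e. both
linear coefficients nonzero — then `q = q′`. [cite: Frohlich1968, Ch. I §3 Thm. 2] -/
theorem eq_of_expand_eq_expand (hq : q ≠ 0) (hq' : q' ≠ 0) {g g' : PowerSeries R}
    (hg0 : PowerSeries.constantCoeff g = 0) (hg'0 : PowerSeries.constantCoeff g' = 0)
    (hg1 : PowerSeries.coeff 1 g ≠ 0) (hg'1 : PowerSeries.coeff 1 g' ≠ 0)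
    (h : PowerSeries.expand q hq g = PowerSeries.expand q' hq' g') : q = q' := by
  by_contra hne
  rcases lt_or_gt_of_ne hne with hlt | hlt
  · apply hg1
    rw [← coeff_expand_self hq g, h, coeff_expand_eq_zero_of_lt hq' hg'0 hlt]
  · apply hg'1
    rw [← coeff_expand_self hq' g', ← h, coeff_expand_eq_zero_of_lt hq hg0 hlt]

/-- **Uniqueness of the factor**: `g(X^q) = g′(X^q) ⇒ g = g′`. [cite: Frohlich1968, Ch. I §3 Thm. 2] -/
theorem expand_injective (hq : q ≠ 0) : Function.Injective (PowerSeries.expand q hq : PowerSeries R → PowerSeries R) := by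
  intro g g' h
  ext m
  rw [← PowerSeries.coeff_expand_mul q hq g m, h, PowerSeries.coeff_expand_mul]

variable (p : ℕ) [hp : Fact p.Prime]

/-- **UNIQUENESS in Fröhlich's Thm. 2**: the height factorisation `f(X) = g(X^{p^n})`, `g′(0) ≠ 0`, of a homomorphism is unique — if also
`f(X) = g′(X^{p^{n′}})` with `g′` a homomorphism (from any twist) and `g′′(0) ≠ 0`, then `n = n′` and the series of `g`, `g′` coincide.
[cite: Frohlich1968, Ch. I §3 Thm. 2] -/
theorem FormalGroupHom.expand_pow_unique {F G : FormalGroup R} {F₁ F₂ : FormalGroup R} {n n' : ℕ}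
    (g : FormalGroupHom F₁ G) (g' : FormalGroupHom F₂ G) (f : FormalGroupHom F G)
    (hg : f.toPowerSeries = PowerSeries.expand (p ^ n) (pow_ne_zero n hp.out.ne_zero) g.toPowerSeries)
    (hg' : f.toPowerSeries = PowerSeries.expand (p ^ n') (pow_ne_zero n' hp.out.ne_zero) g'.toPowerSeries)
    (h1 : PowerSeries.coeff 1 g.toPowerSeries ≠ 0) (h1' : PowerSeries.coeff 1 g'.toPowerSeries ≠ 0) :
    n = n' ∧ g.toPowerSeries = g'.toPowerSeries := by
  have hq : p ^ n = p ^ n' :=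
    eq_of_expand_eq_expand _ _ g.constantCoeff_eq_zero g'.constantCoeff_eq_zero h1 h1' (hg.symm.trans hg')
  have hn : n = n' := Nat.pow_right_injective hp.out.two_le hq
  subst hn
  exact ⟨rfl, expand_injective _ (hg.symm.trans hg')⟩

end Unique

end Literature.RingTheory.FormalGroups
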